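import Mathlib
import Literature.Computability.Complexity.RangeAvoidance
import Literature.Computability.Complexity.SignDegreeXor
import Literature.Computability.MetaComplexity.PolynomialCalculus
import Summits.PneNP.PneNP.Theorems.PstarPDT

/-!
# The fibre `I(z) = y` of a pure `P⋆` instance as a polynomial system over `𝔽₂` (ROUND-24 pre-seed, interface for T24.3 / T21.2)

FRONTIER range-avoidance ladder, rung F-N3 (cell `pnp-ideate`; restricted-model proof complexity — nothing here bears on `P` vs `NP`).

The tree's polynomial calculus (`Literature.Computability.MetaComplexity.PC.DerivableInDegree / RefutableInDegree`, Boolean axioms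
built in) lets the two algebraic rungs above Sherali–Adams be stated over ONE axiom set.  For a pure `P⋆ = u₀ ⊕ u₁ ⊕ u₂u₃` instance
`I : LocalMap 4 n m` and a target `y`, output `j` reading `(u, v, p, q)` contributes the Zhegalkin polynomial
`pstarPoly I j = X u + X v + X p · X q ∈ 𝔽₂[X]` and the AXIOM `pstarPoly I j + y_j` (`fibrePolys I y`), which vanishes at a Boolean
point `z` exactly when output `j` is satisfied (`eval_fibreAxiom_eq_zero_iff`).  Hence (`not_mem_range_of_refutable`, via ideal
membership `PC.DerivableInDegree.mem_span`) a PC/𝔽₂ refutation of `fibrePolys I y` in ANY degree certifies `y ∉ Range(I)`.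
The two named targets this interface serves (memo HOME/pnp-ideate-p3/r24/ROUND-24-PRESEED.md §6(3)):
* T24.3  `T.Solves I y → PC.RefutableInDegree (fibrePolys I y) (T.depth + 3)` for parity decision trees `T` (`PstarPDT`) — the PDT /
  tree-like `Res(⊕)` rung sits below the `PC_𝔽₂`-degree rung;
* T21.2  (named open problem) `¬ PC.RefutableInDegree (fibrePolys I y) (n / c)` for the boundary-expanding typed families, every `y`.
Contrast `…ExpanderLinearGeneratorsPolyCalcCharTwo` (pure XOR systems are PC/𝔽₂-easy in degree = sparsity): here the AND layer is
what could make degree grow, and Sherali–Adams (R21–R23) cannot even see the XOR layer's Gaussian elimination.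
-/

set_option linter.dupNamespace false

open MvPolynomial Literature.Computability.Complexity
open Literature.Computability.MetaComplexity

namespace Summit.PneNP.PneNP.Theorems.PstarFibrePolys

variable {n m : ℕ}

/-- `Bool ↪ 𝔽₂`. -/
def bit (b : Bool) : ZMod 2 := if b then 1 else 0

/-- `bit` turns `xor` into `+`. -/
theorem bit_xor (a b : Bool) : bit (xor a b) = bit a + bit b := by
  cases a <;> cases b <;> decide

/-- `bit` turns `&&` into `·`. -/
theorem bit_and (a b : Bool) : bit (a && b) = bit a * bit b := by
  cases a <;> cases b <;> decide

/-- `bit` is injective. -/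
theorem bit_injective : Function.Injective bit := by
  intro a b h; cases a <;> cases b <;> first | rfl | exact absurd h (by decide)

/-- `bit a + bit b = 0 ↔ a = b` in `𝔽₂`. -/
theorem bit_add_bit_eq_zero_iff (a b : Bool) : bit a + bit b = 0 ↔ a = b := by
  cases a <;> cases b <;> decide

/-- The Zhegalkin polynomial of output `j`: `X u + X v + X p · X q` for the slots `(u, v, p, q) = I.vars j`. -/
noncomputable def pstarPoly (I : LocalMap 4 n m) (j : Fin m) : MvPolynomial (Fin n) (ZMod 2) :=
  X (I.vars j 0) + X (I.vars j 1) + X (I.vars j 2) * X (I.vars j 3)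

/-- The axiom polynomial of output `j` for target `y`: `pstarPoly I j + y_j` (read as the equation `= 0`, i.e. `P⋆_j(z) = y_j`). -/
noncomputable def fibreAxiom (I : LocalMap 4 n m) (y : Fin m → Bool) (j : Fin m) : MvPolynomial (Fin n) (ZMod 2) :=
  pstarPoly I j + C (bit (y j))

/-- The polynomial system of the fibre `I(z) = y`. -/
noncomputable def fibrePolys (I : LocalMap 4 n m) (y : Fin m → Bool) : Set (MvPolynomial (Fin n) (ZMod 2)) :=
  Set.range (fibreAxiom I y)

/-- At a Boolean point the Zhegalkin polynomial computes the output bit (pure `P⋆` instances). -/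
theorem eval_pstarPoly (I : LocalMap 4 n m) (hI : I.IsPure xorAndPred) (z : Fin n → Bool) (j : Fin m) :
    MvPolynomial.eval (fun v => bit (z v)) (pstarPoly I j) = bit (I.eval z j) := by
  have htab : I.table j = xorAndPred := hI.1 j
  simp only [pstarPoly, map_add, map_mul, eval_X, LocalMap.eval, htab, xorAndPred_apply, bit_xor, bit_and]

/-- The axiom of output `j` vanishes at a Boolean point iff the output is satisfied there. -/
theorem eval_fibreAxiom_eq_zero_iff (I : LocalMap 4 n m) (hI : I.IsPure xorAndPred) (z : Fin n → Bool) (y : Fin m → Bool)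
    (j : Fin m) : MvPolynomial.eval (fun v => bit (z v)) (fibreAxiom I y j) = 0 ↔ I.eval z j = y j := by
  simp only [fibreAxiom, map_add, eval_C, eval_pstarPoly I hI, bit_add_bit_eq_zero_iff]

/-- The axioms have degree `≤ 2` (so they are usable from degree `2` on in `PC.DerivableInDegree`). -/
theorem totalDegree_fibreAxiom_le (I : LocalMap 4 n m) (y : Fin m → Bool) (j : Fin m) : (fibreAxiom I y j).totalDegree ≤ 2 := by
  unfold fibreAxiom pstarPoly
  refine (totalDegree_add _ _).trans (max_le ?_ ((totalDegree_C _).le.trans (by norm_num)))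
  refine (totalDegree_add _ _).trans (max_le ?_ ?_)
  · refine (totalDegree_add _ _).trans (max_le ?_ ?_) <;> exact (totalDegree_X _).le.trans (by norm_num)
  · refine (totalDegree_mul _ _).trans ?_
    rw [totalDegree_X, totalDegree_X]

/-- **Soundness**: a PC/𝔽₂ refutation of the fibre system in any degree certifies that the target is outside the range. -/
theorem not_mem_range_of_refutable (I : LocalMap 4 n m) (hI : I.IsPure xorAndPred) (y : Fin m → Bool) {d : ℕ}
    (h : PC.RefutableInDegree (fibrePolys I y) d) : y ∉ I.range := by
  rintro ⟨x, hx⟩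
  let φ : MvPolynomial (Fin n) (ZMod 2) →+* ZMod 2 := MvPolynomial.eval fun v => bit (x v)
  have hle : Ideal.span (fibrePolys I y ∪ Set.range fun j : Fin n => (X j ^ 2 - X j : MvPolynomial (Fin n) (ZMod 2)))
      ≤ RingHom.ker φ := by
    rw [Ideal.span_le]
    rintro g (⟨j, rfl⟩ | ⟨v, rfl⟩)
    · show φ (fibreAxiom I y j) = 0
      exact (eval_fibreAxiom_eq_zero_iff I hI x y j).2 (by rw [← hx])
    · show φ (X v ^ 2 - X v) = 0
      simp only [φ, map_sub, map_pow, eval_X]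
      cases x v <;> decide
  have h1 : φ 1 = 0 := hle (PC.DerivableInDegree.mem_span h)
  rw [map_one] at h1
  exact absurd h1 (by decide)

/-- Every axiom is derivable in degree `2` (bookkeeping for T24.3's leaf case). -/
theorem derivable_fibreAxiom (I : LocalMap 4 n m) (y : Fin m → Bool) (j : Fin m) {d : ℕ} (hd : 2 ≤ d) :
    PC.DerivableInDegree (fibrePolys I y) d (fibreAxiom I y j) :=
  PC.DerivableInDegree.hyp ⟨j, rfl⟩ ((totalDegree_fibreAxiom_le I y j).trans hd)

end Summit.PneNP.PneNP.Theorems.PstarFibrePolys
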